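import Literature.Combinatorics.SimpleGraph.MengerTwo
import Literature.Probability.Percolation.OneArmLSW
import HarnessLib

/-!
# The two-chain criterion for two disjoint continuations (abstract exterior Menger step)

Topic `Literature/Probability/Percolation`; family `crit-perc` / near-critical percolation on `𝕋`.
A brick of the near-critical arm-separation theorem for four arms in the ADJACENT colour
arrangement (P. Nolin, EJP 13 (2008), Thm. 11, `j = 4`, `σ = BBWW` [arXiv 0711.4948: Thm. 10]):
the landing step for two arms of the SAME colour, whose fenced exits may nest across scales so
that no private corridor regions exist. Abstract form of the remedy: two vertex-disjoint routes
`R₁`, `R₂` (sets), and for each route TWO continuation structures `Q_{i,α}`, `Q_{i,β}` (sets;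
every site of `Q_{i,c}` joined to the start `aᵢ` inside `Rᵢ ∪ Q_{i,c}`; each meeting the target set), with
`Q_{i,α} ∩ Q_{i,β} = ∅` for each `i` — the structures of DIFFERENT routes may meet arbitrarily.
Then no single vertex separates `{a₁, a₂}` from the targets inside the union (a vertex misses one
route, and one of that route's two structures), so Menger's theorem for two paths
(`exists_two_disjoint_paths`) gives two vertex-disjoint paths from `a₁` and from `a₂` to the
targets: `exists_two_disjoint_paths_of_two_chains`. Everything here is proved.

## References

* P. Nolin, Near-critical percolation in two dimensions, *Electron. J. Probab.* 13 (2008), §4.3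
  Prop. 12, §4.4 (arXiv 0711.4948: Prop. 11; proof of Thm. 10) [Nolin2008].
* R. Diestel, *Graph Theory*, 5th ed. (2017), Thm. 3.3.1 (Menger) [Diestel2017].
-/

namespace Literature.Probability.Percolation

open Literature.Combinatorics.SimpleGraph

variable {V : Type*} {G : SimpleGraph V}

/-- **Two routes with two continuation structures each give two disjoint paths to the targets.**
See the module docstring. [cite: Nolin2008, §4.4 (arXiv 0711.4948: proof of Thm. 10)] [cite: Diestel2017, Thm. 3.3.1] -/
theorem exists_two_disjoint_paths_of_two_chains {a : Fin 2 → V} {R : Fin 2 → Set V} {Q : Fin 2 → Bool → Set V}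
    {Tg : Set V}
    (hQ : ∀ i b, ∀ v ∈ Q i b, PathIn G (R i ∪ Q i b) (a i) v) (hTg : ∀ i b, ∃ t ∈ Q i b, t ∈ Tg)
    (hdisjR : Disjoint (R 0) (R 1)) (hdisjQ : ∀ i, Disjoint (Q i true) (Q i false)) :
    ∃ (t₁ t₂ : V) (p₁ : G.Walk (a 0) t₁) (p₂ : G.Walk (a 1) t₂), t₁ ∈ Tg ∧ t₂ ∈ Tg ∧ p₁.IsPath ∧ p₂.IsPath ∧
      (∀ y ∈ p₁.support, y ∈ (⋃ i, R i) ∪ ⋃ i, ⋃ b, Q i b) ∧ (∀ y ∈ p₂.support, y ∈ (⋃ i, R i) ∪ ⋃ i, ⋃ b, Q i b) ∧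
      ∀ y ∈ p₁.support, y ∉ p₂.support := by
  classical
  set A : Set V := (⋃ i, R i) ∪ ⋃ i, ⋃ b, Q i b with hA
  have hQA : ∀ i b, R i ∪ Q i b ⊆ A := fun i b v hv => by
    rcases hv with hv | hv
    · exact Or.inl (Set.mem_iUnion.2 ⟨i, hv⟩)
    · exact Or.inr (Set.mem_iUnion.2 ⟨i, Set.mem_iUnion.2 ⟨b, hv⟩⟩)
  -- a route through `R i ∪ Q i b` to a target, as a walk
  have route : ∀ i b, ∃ (t : V) (q : G.Walk (a i) t), t ∈ Tg ∧ ∀ y ∈ q.support, y ∈ R i ∪ Q i b := fun i b => by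
    obtain ⟨t, htQ, htT⟩ := hTg i b
    obtain ⟨w, hw⟩ := (hQ i b t htQ).exists_walk
    exact ⟨t, w, htT, hw⟩
  have hone : ∃ (s t : V) (q : G.Walk s t), s ∈ ({a 0, a 1} : Set V) ∧ t ∈ Tg ∧ ∀ y ∈ q.support, y ∈ A := by
    obtain ⟨t, q, ht, hq⟩ := route 0 true
    exact ⟨a 0, t, q, by simp, ht, fun y hy => hQA 0 true (hq y hy)⟩
  have hcut : ∀ z ∈ A, ∃ (s t : V) (q : G.Walk s t), s ∈ ({a 0, a 1} : Set V) ∧ t ∈ Tg ∧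
      (∀ y ∈ q.support, y ∈ A) ∧ z ∉ q.support := by
    intro z _
    -- a route missing `z`: the route `i` with `z ∉ R i`, the structure `b` with `z ∉ Q i b`
    obtain ⟨i, hi⟩ : ∃ i : Fin 2, z ∉ R i := by
      by_contra h
      push Not at h
      exact Set.disjoint_left.1 hdisjR (h 0) (h 1)
    obtain ⟨b, hb⟩ : ∃ b : Bool, z ∉ Q i b := by
      by_contra h
      push Not at h
      exact Set.disjoint_left.1 (hdisjQ i) (h true) (h false)
    obtain ⟨t, q, ht, hq⟩ := route i b
    refine ⟨a i, t, q, ?_, ht, fun y hy => hQA i b (hq y hy), fun hz => ?_⟩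
    · fin_cases i <;> simp
    · rcases hq z hz with h | h
      · exact hi h
      · exact hb h
  obtain ⟨s₁, t₁, s₂, t₂, p₁, p₂, hs₁, ht₁, hs₂, ht₂, hp₁, hp₂, hA₁, hA₂, hdisj⟩ :=
    exists_two_disjoint_paths (G := G) hone hcut
  -- the two starts are the two sources, in some order
  have hne : s₁ ≠ s₂ := fun h => hdisj s₁ p₁.start_mem_support (h ▸ p₂.start_mem_support)
  simp only [Set.mem_insert_iff, Set.mem_singleton_iff] at hs₁ hs₂
  rcases hs₁ with rfl | rfl
  · rcases hs₂ with rfl | rfl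
    · exact absurd rfl hne
    · exact ⟨t₁, t₂, p₁, p₂, ht₁, ht₂, hp₁, hp₂, hA₁, hA₂, hdisj⟩
  · rcases hs₂ with rfl | rfl
    · exact ⟨t₂, t₁, p₂, p₁, ht₂, ht₁, hp₂, hp₁, hA₂, hA₁, fun y hy hy' => hdisj y hy' hy⟩
    · exact absurd rfl hne

end Literature.Probability.Percolation
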